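import Literature.Topology.FourManifolds.SimplifiedBrokenLefschetzRoundHessian
import Literature.Topology.FourManifolds.SimplifiedBrokenLefschetzRoundCircle
import Literature.Topology.FourManifolds.TubeLongitude
import HarnessLib

/-!
# A longitude-adapted tubular neighbourhood of the round circle of a simplified broken
# Lefschetz fibration

Topic `Literature/Topology/FourManifolds`; groundwork (brick F2 of the fact seat's plan) for the
Morse–Bott tube of the round circle used in the proof of
`nonempty_diffeomorph_sphere_four_of_sblf_genus_one_noLefschetz`
(`SimplifiedBrokenLefschetzFibration.lean`; Baykur–Kamada 2015, §5 ¶1: *"the round cobordism …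
is a fibrewise handle attachment along the round singular circle"*).  Everything here is
**proved**; there are no definitions and no named facts.

Let `f : X → S²` be an SBLF on a closed oriented 4-manifold whose round image is the equator
(`exists_image_round_eq_sphereEquator`), `Z` its round locus, `e : S¹ ↪ X` the longitude
parametrisation of `Z` (`exists_isSmoothEmbedding_range_eq_round`: `f (e u) = (u₀, u₁, 0)`).

* `RoundTube.contMDiff_reparam`, `RoundTube.isLocalDiffeomorph_reparam` — an angular
  reparametrisation `(u, x) ↦ (τ(u, x), x)` of `S¹ × F` given by a `1`-equivariant lift
  `τ : ℝ × F → ℝ` (`τ (s + 1, x) = τ (s, x) + 1`) with an equivariant inverse is a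
  diffeomorphism of `S¹ × F` (it is smooth because locally `u = circlePt s` with a smooth angle
  `s = angA u` or `angB u`, `TorusCoordinates.lean`).
* `CircleNbhd.isLocalDiffeomorph` — an open tubular neighbourhood `S¹ × ℝ³ ↪ X⁴` is a local
  diffeomorphism (equidimensional embedding, Hirsch 1976, Ch. 1 §3).
* `IsSimplifiedBrokenLefschetzFibration.exists_circleNbhd_longitude` — **there is an open tubular
  neighbourhood `ν : S¹ × ℝ³ ↪ X` of the round circle, `ν (u, 0) = e u`, adapted to the
  longitude of `f`: the horizontal part `((f ν(u, x))₀, (f ν(u, x))₁)` of `f` is a positive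
  multiple of `u` for every `(u, x)`**; in other words `f ∘ ν` maps the normal disc over `u`
  into the open meridian half-great-circle-sector through `(u, 0)`, so that the pages
  `{u = const}` of the tube lie in the fibres of the longitude `S² ∖ {poles} → S¹`.  It is
  obtained from any tubular neighbourhood (`nonempty_circleNbhd_of_compactSpace`) by straightening
  the longitude along the tube (`RoundTube.exists_longitude_straightening`, `TubeLongitude.lean`)
  and shrinking the normal disc (`prodUnivBall`).

## References

* R. İ. Baykur, S. Kamada, *Classification of broken Lefschetz fibrations with small fiber
  genera*, J. Math. Soc. Japan 67 (2015), §2, §5. [BaykurKamada2015]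
* M. W. Hirsch, *Differential Topology*, Springer GTM 33 (1976), Ch. 1 §3, Ch. 4 §5.
  [HirschDT1976]
* R. E. Gompf, A. I. Stipsicz, *4-Manifolds and Kirby Calculus* (1999), §5.2 (tubular
  neighbourhoods of circles). [GompfStipsicz1999]
-/

noncomputable section

open scoped Manifold ContDiff Topology Real
open Set Function Filter Metric

namespace Literature.Topology.FourManifolds

universe u

namespace RoundTube

/-! ### Angular reparametrisations of `S¹ × F` -/

section Reparam

variable {F : Type*}

/-- A `1`-equivariant map is `ℤ`-equivariant. [folklore] -/
theorem apply_add_int_eq {τ : ℝ × F → ℝ} (hτT : ∀ s x, τ (s + 1, x) = τ (s, x) + 1) (s : ℝ)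
    (x : F) (m : ℤ) : τ (s + m, x) = τ (s, x) + m := by
  induction m using Int.induction_on with
  | zero => simp
  | succ n ih =>
    push_cast at ih ⊢
    rw [show s + (n + 1 : ℝ) = s + n + 1 by ring, hτT, ih]
    ring
  | pred n ih =>
    push_cast at ih ⊢
    have h := hτT (s + (-(n : ℝ) - 1)) x
    rw [show s + (-(n : ℝ) - 1) + 1 = s + -(n : ℝ) by ring, ih] at h
    linarith

/-- `circlePt ∘ τ` does not depend on the lift of the angle. [folklore] -/
theorem circlePt_apply_eq_of_circlePt_eq {τ : ℝ × F → ℝ}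
    (hτT : ∀ s x, τ (s + 1, x) = τ (s, x) + 1) {s s' : ℝ} (h : circlePt s = circlePt s')
    (x : F) : circlePt (τ (s, x)) = circlePt (τ (s', x)) := by
  obtain ⟨m, rfl⟩ := circlePt_eq_circlePt_iff.1 h
  rw [apply_add_int_eq hτT, circlePt_add_int]

/-- The angular reparametrisation computed with any lift of the angle. [folklore] -/
theorem reparam_apply_of_eq {τ : ℝ × F → ℝ} (hτT : ∀ s x, τ (s + 1, x) = τ (s, x) + 1)
    {s : ℝ} {u : Metric.sphere (0 : EuclideanSpace ℝ (Fin 2)) 1} (hu : circlePt s = u)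
    (x : F) :
    ((circlePt (τ (angA u, x)), x) : Metric.sphere (0 : EuclideanSpace ℝ (Fin 2)) 1 × F) =
      (circlePt (τ (s, x)), x) := by
  rw [circlePt_apply_eq_of_circlePt_eq hτT ((circlePt_angA u).trans hu.symm) x]

/-- **The angular reparametrisation `(u, x) ↦ (circlePt (τ (s, x)), x)` (`u = circlePt s`) of
`S¹ × F` by a smooth `1`-equivariant `τ` is smooth.** [folklore] -/
theorem contMDiff_reparam [NormedAddCommGroup F] [NormedSpace ℝ F] {τ : ℝ × F → ℝ}
    (hτs : ContDiff ℝ ∞ τ)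
    (hτT : ∀ s x, τ (s + 1, x) = τ (s, x) + 1) :
    ContMDiff ((𝓡 1).prod 𝓘(ℝ, F)) ((𝓡 1).prod 𝓘(ℝ, F)) ∞
      (fun q : Metric.sphere (0 : EuclideanSpace ℝ (Fin 2)) 1 × F =>
        ((circlePt (τ (angA q.1, q.2)), q.2) :
          Metric.sphere (0 : EuclideanSpace ℝ (Fin 2)) 1 × F)) := by
  have hτM := contMDiff_prod_of_contDiff hτs
  have key : ∀ (ang : Metric.sphere (0 : EuclideanSpace ℝ (Fin 2)) 1 → ℝ)
      (q : Metric.sphere (0 : EuclideanSpace ℝ (Fin 2)) 1 × F),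
      ContMDiffAt (𝓡 1) 𝓘(ℝ, ℝ) ∞ ang q.1 →
      ContMDiffAt ((𝓡 1).prod 𝓘(ℝ, F)) ((𝓡 1).prod 𝓘(ℝ, F)) ∞
        (fun q : Metric.sphere (0 : EuclideanSpace ℝ (Fin 2)) 1 × F =>
          ((circlePt (τ (ang q.1, q.2)), q.2) :
            Metric.sphere (0 : EuclideanSpace ℝ (Fin 2)) 1 × F)) q := fun ang q hang => by
    have h1 : ContMDiffAt ((𝓡 1).prod 𝓘(ℝ, F)) (𝓘(ℝ, ℝ).prod 𝓘(ℝ, F)) ∞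
        (fun q : Metric.sphere (0 : EuclideanSpace ℝ (Fin 2)) 1 × F => (ang q.1, q.2)) q :=
      (hang.comp q contMDiffAt_fst).prodMk contMDiffAt_snd
    have h2 : ContMDiffAt ((𝓡 1).prod 𝓘(ℝ, F)) 𝓘(ℝ, ℝ) ∞
        (fun q : Metric.sphere (0 : EuclideanSpace ℝ (Fin 2)) 1 × F => τ (ang q.1, q.2)) q :=
      hτM.contMDiffAt.comp q h1
    exact (contMDiff_circlePt.contMDiffAt.comp q h2).prodMk contMDiffAt_snd
  intro q
  by_cases hA : q.1 = ptA
  · have hB : q.1 ≠ ptB := fun h => ptA_ne_ptB (hA.symm.trans h)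
    have hfun : (fun q : Metric.sphere (0 : EuclideanSpace ℝ (Fin 2)) 1 × F =>
        ((circlePt (τ (angA q.1, q.2)), q.2) :
          Metric.sphere (0 : EuclideanSpace ℝ (Fin 2)) 1 × F)) =
        fun q => (circlePt (τ (angB q.1, q.2)), q.2) :=
      funext fun q => reparam_apply_of_eq hτT (circlePt_angB q.1) q.2
    rw [hfun]
    exact key angB q (contMDiffAt_angB hB)
  · exact key angA q (contMDiffAt_angA hA)

/-- The reparametrisations by `τ` and by a `t`-inverse `Λ` of `τ` are inverse to each other.
[folklore] -/
theorem reparam_reparam {τ Λ : ℝ × F → ℝ} (hτT : ∀ s x, τ (s + 1, x) = τ (s, x) + 1)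
    (hτΛ : ∀ t x, τ (Λ (t, x), x) = t) (q : Metric.sphere (0 : EuclideanSpace ℝ (Fin 2)) 1 × F) :
    ((circlePt (τ (angA (circlePt (Λ (angA q.1, q.2))), q.2)), q.2) :
        Metric.sphere (0 : EuclideanSpace ℝ (Fin 2)) 1 × F) = q := by
  obtain ⟨u, x⟩ := q
  show ((circlePt (τ (angA (circlePt (Λ (angA u, x))), x)), x) :
      Metric.sphere (0 : EuclideanSpace ℝ (Fin 2)) 1 × F) = (u, x)
  rw [reparam_apply_of_eq hτT (rfl : circlePt (Λ (angA u, x)) = circlePt (Λ (angA u, x))), hτΛ,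
    circlePt_angA]

/-- **The angular reparametrisation by a smooth equivariant `τ` with a smooth equivariant
`t`-inverse is a diffeomorphism of `S¹ × F`**, in particular a local diffeomorphism. [folklore] -/
theorem isLocalDiffeomorph_reparam [NormedAddCommGroup F] [NormedSpace ℝ F] {τ Λ : ℝ × F → ℝ}
    (hτs : ContDiff ℝ ∞ τ) (hΛs : ContDiff ℝ ∞ Λ)
    (hτT : ∀ s x, τ (s + 1, x) = τ (s, x) + 1) (hΛT : ∀ t x, Λ (t + 1, x) = Λ (t, x) + 1)
    (hΛτ : ∀ s x, Λ (τ (s, x), x) = s) (hτΛ : ∀ t x, τ (Λ (t, x), x) = t) :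
    IsLocalDiffeomorph ((𝓡 1).prod 𝓘(ℝ, F)) ((𝓡 1).prod 𝓘(ℝ, F)) ∞
      (fun q : Metric.sphere (0 : EuclideanSpace ℝ (Fin 2)) 1 × F =>
        ((circlePt (τ (angA q.1, q.2)), q.2) :
          Metric.sphere (0 : EuclideanSpace ℝ (Fin 2)) 1 × F)) := by
  let Φ : (Metric.sphere (0 : EuclideanSpace ℝ (Fin 2)) 1 × F) ≃ₘ⟮(𝓡 1).prod 𝓘(ℝ, F),
      (𝓡 1).prod 𝓘(ℝ, F)⟯ (Metric.sphere (0 : EuclideanSpace ℝ (Fin 2)) 1 × F) :=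
    { toFun := fun q => (circlePt (τ (angA q.1, q.2)), q.2)
      invFun := fun q => (circlePt (Λ (angA q.1, q.2)), q.2)
      left_inv := fun q => reparam_reparam hΛT hΛτ q
      right_inv := fun q => reparam_reparam hτT hτΛ q
      contMDiff_toFun := contMDiff_reparam hτs hτT
      contMDiff_invFun := contMDiff_reparam hΛs hΛT }
  exact Φ.isLocalDiffeomorph

/-- The angular reparametrisation is injective. [folklore] -/
theorem injective_reparam {τ Λ : ℝ × F → ℝ} (hΛT : ∀ t x, Λ (t + 1, x) = Λ (t, x) + 1)
    (hΛτ : ∀ s x, Λ (τ (s, x), x) = s) :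
    Injective (fun q : Metric.sphere (0 : EuclideanSpace ℝ (Fin 2)) 1 × F =>
      ((circlePt (τ (angA q.1, q.2)), q.2) :
        Metric.sphere (0 : EuclideanSpace ℝ (Fin 2)) 1 × F)) :=
  HasLeftInverse.injective ⟨fun q => (circlePt (Λ (angA q.1, q.2)), q.2),
    fun q => reparam_reparam hΛT hΛτ q⟩

end Reparam

end RoundTube

/-! ### The longitude-adapted tube of the round circle -/

namespace IsSimplifiedBrokenLefschetzFibration

variable {X : Type u} [TopologicalSpace X] [ChartedSpace (EuclideanSpace ℝ (Fin 4)) X]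
  [IsManifold (𝓡 4) ∞ X] {o : SmoothOrientation (𝓡 4) X}
  {f : X → (Metric.sphere (0 : EuclideanSpace ℝ (Fin 3)) 1)} {L : Finset X} {h : ℕ}

/-- **A longitude-adapted tubular neighbourhood of the round circle.**  Let `f : X → S²` be a
simplified broken Lefschetz fibration on a closed oriented 4-manifold whose round image is the
equator.  Then the round locus `Z` is a smoothly embedded circle `e : S¹ ↪ X` with
`f (e u) = (u₀, u₁, 0)` (`exists_isSmoothEmbedding_range_eq_round`), and `e` has an open tubular
neighbourhood `ν : S¹ × ℝ³ ↪ X` (`ν (u, 0) = e u`) **whose pages `{u} × ℝ³` are mapped by `f`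
into the open meridian sector of `S²` through `(u, 0)`**: the horizontal part of `f (ν (u, x))`
is `ρ • u` with `ρ = ‖horizontal part‖ > 0`.  (Tubular neighbourhood of a circle in an
orientable 4-manifold, Gompf–Stipsicz 1999, §5.2, reparametrised along the longitude of `f`,
which is a submersion onto `S¹` near `Z` since `f ∘ e` is the equator; Baykur–Kamada 2015, §5
¶1.) [cite: BaykurKamada2015, §5] [cite: GompfStipsicz1999, §5.2]
[cite: HirschDT1976, Ch. 4 §5] -/
theorem exists_circleNbhd_longitude [T2Space X] [CompactSpace X]
    (hf : IsSimplifiedBrokenLefschetzFibration o f L h)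
    (hround : f '' ({p : X | ¬ Surjective (mfderiv (𝓡 4) (𝓡 2) f p)} \ (↑L : Set X)) =
      sphereEquator 1) :
    ∃ (e : Metric.sphere (0 : EuclideanSpace ℝ (Fin 2)) 1 → X) (ν : CircleNbhd (𝓡 4) e),
      Manifold.IsSmoothEmbedding (𝓡 1) (𝓡 4) ∞ e ∧
      range e = {p : X | ¬ Surjective (mfderiv (𝓡 4) (𝓡 2) f p)} \ (↑L : Set X) ∧
      (∀ u, f (e u) = sphereInclusion 1 2 one_le_two u) ∧
      ∀ (u : Metric.sphere (0 : EuclideanSpace ℝ (Fin 2)) 1) (x : EuclideanSpace ℝ (Fin 3)),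
        (f (ν.toFun (u, x)) : EuclideanSpace ℝ (Fin 3)) 0 =
            √((f (ν.toFun (u, x)) : EuclideanSpace ℝ (Fin 3)) 0 ^ 2 +
                (f (ν.toFun (u, x)) : EuclideanSpace ℝ (Fin 3)) 1 ^ 2) *
              (u : EuclideanSpace ℝ (Fin 2)) 0 ∧
          (f (ν.toFun (u, x)) : EuclideanSpace ℝ (Fin 3)) 1 =
            √((f (ν.toFun (u, x)) : EuclideanSpace ℝ (Fin 3)) 0 ^ 2 +
                (f (ν.toFun (u, x)) : EuclideanSpace ℝ (Fin 3)) 1 ^ 2) *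
              (u : EuclideanSpace ℝ (Fin 2)) 1 ∧
          0 < (f (ν.toFun (u, x)) : EuclideanSpace ℝ (Fin 3)) 0 ^ 2 +
            (f (ν.toFun (u, x)) : EuclideanSpace ℝ (Fin 3)) 1 ^ 2 := by
  -- the round circle `e` and a tubular neighbourhood `ν` of it
  obtain ⟨e, he, hrange, hfe⟩ := hf.exists_isSmoothEmbedding_range_eq_round hround
  obtain ⟨ν⟩ := nonempty_circleNbhd_of_compactSpace ⟨o⟩ e he
  -- the fibration along the tube, lifted to `ℝ × ℝ³`
  obtain ⟨P, hP⟩ : ∃ P : ℝ × EuclideanSpace ℝ (Fin 3) → EuclideanSpace ℝ (Fin 3),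
      P = fun q => (f (ν.toFun (circlePt q.1, q.2)) : EuclideanSpace ℝ (Fin 3)) := ⟨_, rfl⟩
  have hPM : ContMDiff (𝓘(ℝ, ℝ).prod 𝓘(ℝ, EuclideanSpace ℝ (Fin 3)))
      𝓘(ℝ, EuclideanSpace ℝ (Fin 3)) ∞ P := by
    haveI : Fact (Module.finrank ℝ (EuclideanSpace ℝ (Fin 3)) = 2 + 1) :=
      ⟨finrank_euclideanSpace_fin⟩
    rw [hP]
    exact (contMDiff_coe_sphere (n := 2) (E := EuclideanSpace ℝ (Fin 3))).comp
      (hf.contMDiff.comp (ν.isSmoothEmbedding.contMDiff.comp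
        (contMDiff_circlePt.prodMap contMDiff_id)))
  have hPs : ContDiff ℝ ∞ P := RoundTube.contDiff_of_contMDiff_prod hPM
  have hP₀s : ContDiff ℝ ∞ fun q => P q 0 := contDiff_euclidean.1 hPs 0
  have hP₁s : ContDiff ℝ ∞ fun q => P q 1 := contDiff_euclidean.1 hPs 1
  have hPT : ∀ (t : ℝ) (x : EuclideanSpace ℝ (Fin 3)), P (t + 1, x) = P (t, x) := fun t x => by
    simp only [hP, circlePt_add_one]
  have hP0 : ∀ t : ℝ, P (t, 0) =
      (sphereInclusion 1 2 one_le_two (circlePt t) : EuclideanSpace ℝ (Fin 3)) := fun t => by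
    simp only [hP, ν.apply_zero, hfe]
  have h0₀ : ∀ t : ℝ, P (t, 0) 0 = Real.cos (2 * π * t) := fun t => by
    rw [hP0, (coe_sphereInclusion_one_two_apply _).1, circlePt_apply_zero]
  have h0₁ : ∀ t : ℝ, P (t, 0) 1 = Real.sin (2 * π * t) := fun t => by
    rw [hP0, (coe_sphereInclusion_one_two_apply _).2, circlePt_apply_one]
  -- straighten the longitude along the tube
  obtain ⟨τ, Λ, r, hτs, hΛs, hr, hΛτ, hτΛ, hτT, hτ0, hlong⟩ :=
    RoundTube.exists_longitude_straightening (P₀ := fun q => P q 0) (P₁ := fun q => P q 1)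
      hP₀s hP₁s (fun t x => by simp only [hPT]) (fun t x => by simp only [hPT]) h0₀ h0₁
  have hΛT : ∀ (t : ℝ) (x : EuclideanSpace ℝ (Fin 3)), Λ (t + 1, x) = Λ (t, x) + 1 :=
    fun t x => by
      have h1 : τ (Λ (t, x) + 1, x) = t + 1 := by rw [hτT, hτΛ]
      rw [← h1, hΛτ]
  -- the new tube `G = ν ∘ σ ∘ pub`: reparametrise the angle by `τ` (`σ`) and shrink the normal
  -- disc to radius `r` (`pub`)
  obtain ⟨pub, hpub⟩ : ∃ pub : Metric.sphere (0 : EuclideanSpace ℝ (Fin 2)) 1 ×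
      EuclideanSpace ℝ (Fin 3) → Metric.sphere (0 : EuclideanSpace ℝ (Fin 2)) 1 ×
      EuclideanSpace ℝ (Fin 3), pub = fun q =>
        (q.1, OpenPartialHomeomorph.univBall (0 : EuclideanSpace ℝ (Fin 3)) r q.2) := ⟨_, rfl⟩
  obtain ⟨σ, hσ⟩ : ∃ σ : Metric.sphere (0 : EuclideanSpace ℝ (Fin 2)) 1 ×
      EuclideanSpace ℝ (Fin 3) → Metric.sphere (0 : EuclideanSpace ℝ (Fin 2)) 1 ×
      EuclideanSpace ℝ (Fin 3), σ = fun q => (circlePt (τ (angA q.1, q.2)), q.2) := ⟨_, rfl⟩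
  have hpub_apply : ∀ q, pub q =
      (q.1, OpenPartialHomeomorph.univBall (0 : EuclideanSpace ℝ (Fin 3)) r q.2) :=
    fun q => by rw [hpub]
  have hσ_apply : ∀ q, σ q = (circlePt (τ (angA q.1, q.2)), q.2) := fun q => by rw [hσ]
  have hσld : IsLocalDiffeomorph ((𝓡 1).prod 𝓘(ℝ, EuclideanSpace ℝ (Fin 3)))
      ((𝓡 1).prod 𝓘(ℝ, EuclideanSpace ℝ (Fin 3))) ∞ σ := by
    rw [hσ]
    exact RoundTube.isLocalDiffeomorph_reparam hτs hΛs hτT hΛT hΛτ hτΛ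
  have hσinj : Injective σ := by
    rw [hσ]
    exact RoundTube.injective_reparam (τ := τ) hΛT hΛτ
  have hpubld : IsLocalDiffeomorph ((𝓡 1).prod 𝓘(ℝ, EuclideanSpace ℝ (Fin 3)))
      ((𝓡 1).prod 𝓘(ℝ, EuclideanSpace ℝ (Fin 3))) ∞ pub := by
    rw [hpub]
    exact fun q => isLocalDiffeomorphAt_prodUnivBall (I := 𝓡 1)
      (M := Metric.sphere (0 : EuclideanSpace ℝ (Fin 2)) 1) (F := EuclideanSpace ℝ (Fin 3)) hr q
  have hpubinj : Injective pub := by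
    intro q q' hqq'
    rw [hpub_apply, hpub_apply] at hqq'
    obtain ⟨h1, h2⟩ := Prod.mk.inj hqq'
    exact Prod.ext h1 (univBall_injective r h2)
  have hνld := ν.isLocalDiffeomorph
  obtain ⟨G, hG⟩ : ∃ G : Metric.sphere (0 : EuclideanSpace ℝ (Fin 2)) 1 × EuclideanSpace ℝ (Fin 3)
      → X, G = ν.toFun ∘ (σ ∘ pub) := ⟨_, rfl⟩
  have hG_apply : ∀ q, G q = ν.toFun (σ (pub q)) := fun q => by rw [hG]; rfl
  have hGld : IsLocalDiffeomorph ((𝓡 1).prod 𝓘(ℝ, EuclideanSpace ℝ (Fin 3))) (𝓡 4) ∞ G := by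
    rw [hG]
    intro q
    exact ((hpubld q).comp (K := (𝓡 1).prod 𝓘(ℝ, EuclideanSpace ℝ (Fin 3)))
      (P := Metric.sphere (0 : EuclideanSpace ℝ (Fin 2)) 1 × EuclideanSpace ℝ (Fin 3))
      (hσld _)).comp (K := 𝓡 4) (P := X) (hνld _)
  have hGinj : Injective G := by
    rw [hG]
    exact ν.isSmoothEmbedding.isEmbedding.injective.comp (hσinj.comp hpubinj)
  have hGemb : Manifold.IsSmoothEmbedding ((𝓡 1).prod 𝓘(ℝ, EuclideanSpace ℝ (Fin 3))) (𝓡 4)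
      ∞ G :=
    isSmoothEmbedding_of_isLocalDiffeomorph hGld hGinj
      (ContinuousLinearEquiv.ofFinrankEq (by simp))
  have hG0 : ∀ u, G (u, 0) = e u := fun u => by
    rw [hG_apply, hpub_apply, hσ_apply]
    dsimp only
    rw [OpenPartialHomeomorph.univBall_apply_zero, hτ0, circlePt_angA, ν.apply_zero]
  -- the longitude property of `G`
  have hGval : ∀ (u : Metric.sphere (0 : EuclideanSpace ℝ (Fin 2)) 1)
      (x : EuclideanSpace ℝ (Fin 3)), (f (G (u, x)) : EuclideanSpace ℝ (Fin 3)) =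
        P (τ (angA u, OpenPartialHomeomorph.univBall (0 : EuclideanSpace ℝ (Fin 3)) r x),
          OpenPartialHomeomorph.univBall (0 : EuclideanSpace ℝ (Fin 3)) r x) := fun u x => by
    rw [hG_apply, hpub_apply, hσ_apply, hP]
  have hGlong : ∀ (u : Metric.sphere (0 : EuclideanSpace ℝ (Fin 2)) 1)
      (x : EuclideanSpace ℝ (Fin 3)),
      (f (G (u, x)) : EuclideanSpace ℝ (Fin 3)) 0 =
          √((f (G (u, x)) : EuclideanSpace ℝ (Fin 3)) 0 ^ 2 +
              (f (G (u, x)) : EuclideanSpace ℝ (Fin 3)) 1 ^ 2) *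
            (u : EuclideanSpace ℝ (Fin 2)) 0 ∧
        (f (G (u, x)) : EuclideanSpace ℝ (Fin 3)) 1 =
          √((f (G (u, x)) : EuclideanSpace ℝ (Fin 3)) 0 ^ 2 +
              (f (G (u, x)) : EuclideanSpace ℝ (Fin 3)) 1 ^ 2) *
            (u : EuclideanSpace ℝ (Fin 2)) 1 ∧
        0 < (f (G (u, x)) : EuclideanSpace ℝ (Fin 3)) 0 ^ 2 +
          (f (G (u, x)) : EuclideanSpace ℝ (Fin 3)) 1 ^ 2 := fun u x => by
    have hx' : ‖OpenPartialHomeomorph.univBall (0 : EuclideanSpace ℝ (Fin 3)) r x‖ < r := by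
      have hb := univBall_mem_ball hr x
      rwa [mem_ball_zero_iff] at hb
    obtain ⟨h₀, h₁, hpos⟩ := hlong (angA u) _ hx'
    beta_reduce at h₀ h₁ hpos
    have hu0 : (u : EuclideanSpace ℝ (Fin 2)) 0 = Real.cos (2 * π * angA u) := by
      have h0 := circlePt_apply_zero (angA u)
      rwa [circlePt_angA] at h0
    have hu1 : (u : EuclideanSpace ℝ (Fin 2)) 1 = Real.sin (2 * π * angA u) := by
      have h1 := circlePt_apply_one (angA u)
      rwa [circlePt_angA] at h1
    rw [hGval, hu0, hu1]
    exact ⟨h₀, h₁, hpos⟩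
  let ν' : CircleNbhd (𝓡 4) e :=
    { toFun := G
      isSmoothEmbedding := hGemb
      isOpen_range := hGld.isOpen_range
      apply_zero := hG0 }
  exact ⟨e, ν', he, hrange, hfe, hGlong⟩

end IsSimplifiedBrokenLefschetzFibration

end Literature.Topology.FourManifolds
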